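import Summits.Ventures.LatticeQCDFlow.Scaling.GroundStatePoincare

/-!
HONEST FRAMING: exact (Metropolis-corrected) sampling algorithms for lattice gauge theory; figures
of merit are autocorrelation/cost numbers at stated couplings and volumes; no continuum-physics
claim.

# TreePoincare — THE PARENT-MAP POINCARÉ INEQUALITY WITH CONGESTION: A SPANNING TREE OF LISTED PAIRS TOWARDS THE HOT LEVEL WITH DEPTH `≤ L` AND AT MOST `B` DESCENDANTS PER LEVEL GIVES
# `Σ_kv_k² ≤ 2LB·Σ_r(v_{i_r} − v_{l_r})² + 2(K+1)·v_0²`, HENCE **`min{t/(2LBm), h/(2(K+1))} ≤ ρ`** FOR EVERY POSITIVE SOLUTION (lean-2 GEN-48, ours)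

Venture-side (OURS).  Cell `lqcd-flow` (pub-lqcd), unit `pub-lqcd-lean-2-g48`, 2026-09-01.  Chapter AI (the sizes of the Robin ground state), file 19 — Mathlib only (through file 3).  File 7's chain
Poincaré inequality charges every chain the whole energy (`a = 2(K+1)L²`); the canonical-path bound with CONGESTION charges each listed pair only the chains through it.  Data: a parent map `p`
with `p 0 = 0`, a depth `d` with `d k = 0 ↔ k = 0` and `d(p k) + 1 = d k` for `k ≠ 0`, `d ≤ L`, every tree pair `{k, p k}` (`k ≠ 0`) listed, and every level `a ≠ 0` having at most `B`
descendants-or-self (`k` with `p^{j}k = a` for some `j < d k`).  Then (§1) `p^{j}k` has depth `d k − j` and `p^{d k}k = 0`; (§2) `(v_k − v_0)² ≤ d_k·Σ_{j<d_k}(v_{p^jk} − v_{p^{j+1}k})²`, the double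
sum regroups as `Σ_a N_a(v_a − v_{pa})²` with `N_a ≤ B`, and distinct `a ≠ 0` have distinct tree pairs, so **`Σv² ≤ 2LB·Σ_r(v_{i_r} − v_{l_r})² + 2(K+1)v_0²`** and file 3 gives
**`min{t/(2LBm), h/(2(K+1))} ≤ ρ`** — the path (`L = B = K`: `t/(2K²m)`), the star (`L = B = 1`: `t/(2m)`), trees in between.  No definitions; no Markov chain.

* §1 `tree_iterate_depth`, `tree_iterate_root`, `tree_iterate_ne_zero`; §2 `tree_sub_sq_le`, `tree_pathEnergy_regroup`, `tree_visits_le_one`, `tree_poincare`, `tree_rho_ge`.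

Literature grade (cell rule): ELEMENTARY (Diaconis–Stroock ∕ Sinclair canonical paths with congestion, for the grounded form of a swap list), NEW TYPING; nothing cited; no new bib keys.
-/

noncomputable section

open Finset Function

namespace Summit.Ventures.LatticeQCDFlow.Scaling

section Tree
variable {K m : ℕ} (e : Fin m → Fin (K + 1) × Fin (K + 1)) {t h ρ : ℝ} {c : Fin (K + 1) → ℝ}
  (p : Fin (K + 1) → Fin (K + 1)) (d : Fin (K + 1) → ℕ)

/-! ## §1 Iterates of the parent map -/

omit e in
/-- Along the parent map the depth drops by one per step: `d(p^{j}k) = d k − j` for `j ≤ d k`. [ours] -/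
theorem tree_iterate_depth (hd0 : ∀ k, d k = 0 ↔ k = 0) (hdp : ∀ k, k ≠ 0 → d (p k) + 1 = d k) (k : Fin (K + 1)) :
    ∀ j : ℕ, j ≤ d k → d (p^[j] k) = d k - j := by
  intro j
  induction j with
  | zero => intro _; simp
  | succ j ih =>
    intro hj
    have hprev := ih (by omega)
    rw [Function.iterate_succ_apply']
    have hne : p^[j] k ≠ 0 := by
      intro h0
      have : d (p^[j] k) = 0 := (hd0 _).mpr h0
      omega
    have := hdp _ hne
    omega

omit e in
/-- `p^{d k}k = 0`: the chain reaches the hot level. [ours] -/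
theorem tree_iterate_root (hd0 : ∀ k, d k = 0 ↔ k = 0) (hdp : ∀ k, k ≠ 0 → d (p k) + 1 = d k) (k : Fin (K + 1)) :
    p^[d k] k = 0 := by
  have := tree_iterate_depth p d hd0 hdp k (d k) le_rfl
  rw [Nat.sub_self] at this
  exact (hd0 _).mp this

omit e in
/-- Before the root the chain avoids `0`: `p^{j}k ≠ 0` for `j < d k`. [ours] -/
theorem tree_iterate_ne_zero (hd0 : ∀ k, d k = 0 ↔ k = 0) (hdp : ∀ k, k ≠ 0 → d (p k) + 1 = d k) (k : Fin (K + 1)) {j : ℕ} (hj : j < d k) :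
    p^[j] k ≠ 0 := by
  intro h0
  have h1 := tree_iterate_depth p d hd0 hdp k j hj.le
  rw [h0] at h1
  have : d (0 : Fin (K + 1)) = 0 := (hd0 0).mpr rfl
  omega

/-! ## §2 The Poincaré inequality with congestion -/

omit e in
/-- **Along the tree: `(v_k − v_0)² ≤ d_k·Σ_{j<d_k}(v_{p^jk} − v_{p^{j+1}k})²`** (telescoping and Cauchy–Schwarz). [ours] -/
theorem tree_sub_sq_le (hd0 : ∀ k, d k = 0 ↔ k = 0) (hdp : ∀ k, k ≠ 0 → d (p k) + 1 = d k) (v : Fin (K + 1) → ℝ) (k : Fin (K + 1)) :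
    (v k - v 0) ^ 2 ≤ (d k : ℝ) * ∑ j ∈ range (d k), (v (p^[j] k) - v (p (p^[j] k))) ^ 2 := by
  have htel : ∑ j ∈ range (d k), (v (p^[j + 1] k) - v (p^[j] k)) = v (p^[d k] k) - v (p^[0] k) :=
    sum_range_sub (fun j => v (p^[j] k)) (d k)
  rw [tree_iterate_root p d hd0 hdp k, Function.iterate_zero, id] at htel
  have hcs : (∑ j ∈ range (d k), (v (p^[j + 1] k) - v (p^[j] k))) ^ 2 ≤ (d k : ℝ) * ∑ j ∈ range (d k), (v (p^[j + 1] k) - v (p^[j] k)) ^ 2 := by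
    have := sq_sum_le_card_mul_sum_sq (s := range (d k)) (f := fun j => v (p^[j + 1] k) - v (p^[j] k))
    rw [card_range] at this
    exact_mod_cast this
  rw [htel] at hcs
  have hsq : (v k - v 0) ^ 2 = (v 0 - v k) ^ 2 := by ring
  rw [hsq]
  refine le_trans hcs (mul_le_mul_of_nonneg_left (le_of_eq (sum_congr rfl fun j _ => ?_)) (Nat.cast_nonneg _))
  rw [Function.iterate_succ_apply']; ring

omit e in
/-- **Regrouping the path energies by tree pair:** `Σ_kΣ_{j<d_k}D(p^jk) = Σ_a D(a)·N_a` with `N_a = Σ_k#{j < d_k : p^jk = a}`. [ours] -/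
theorem tree_pathEnergy_regroup (D : Fin (K + 1) → ℝ) :
    ∑ k : Fin (K + 1), ∑ j ∈ range (d k), D (p^[j] k)
      = ∑ a : Fin (K + 1), D a * ∑ k : Fin (K + 1), (((range (d k)).filter fun j => p^[j] k = a).card : ℝ) := by
  classical
  have hstep : ∀ (k : Fin (K + 1)) (j : ℕ), D (p^[j] k) = ∑ a : Fin (K + 1), if p^[j] k = a then D a else 0 := by
    intro k j; rw [sum_ite_eq univ (p^[j] k), if_pos (mem_univ _)]
  simp_rw [hstep]
  have h1 : ∑ k : Fin (K + 1), ∑ j ∈ range (d k), ∑ a : Fin (K + 1), (if p^[j] k = a then D a else 0)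
      = ∑ k : Fin (K + 1), ∑ a : Fin (K + 1), ∑ j ∈ range (d k), (if p^[j] k = a then D a else 0) :=
    sum_congr rfl fun k _ => sum_comm
  rw [h1, sum_comm]
  refine sum_congr rfl fun a _ => ?_
  rw [mul_sum]
  refine sum_congr rfl fun k _ => ?_
  rw [← sum_filter, sum_const, nsmul_eq_mul, mul_comm]

omit e in
/-- For a fixed level `k`, a level `a` is met at most once along the chain: `#{j < d_k : p^jk = a} ≤ 1`, and `= 0` unless `a` is an ancestor-or-self of `k`. [ours] -/
theorem tree_visits_le_one (hd0 : ∀ k, d k = 0 ↔ k = 0) (hdp : ∀ k, k ≠ 0 → d (p k) + 1 = d k) (k a : Fin (K + 1)) :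
    ((range (d k)).filter fun j => p^[j] k = a).card ≤ 1 := by
  classical
  rw [card_le_one]
  intro i hi j hj
  rw [mem_filter, mem_range] at hi hj
  have h1 := tree_iterate_depth p d hd0 hdp k i hi.1.le
  have h2 := tree_iterate_depth p d hd0 hdp k j hj.1.le
  rw [hi.2] at h1; rw [hj.2] at h2
  omega

/-- **THE TREE POINCARÉ INEQUALITY WITH CONGESTION:** `Σ_kv_k² ≤ 2LB·Σ_r(v_{i_r} − v_{l_r})² + 2(K+1)·v_0²`. [ours] -/
theorem tree_poincare (hp0 : p 0 = 0) (hd0 : ∀ k, d k = 0 ↔ k = 0) (hdp : ∀ k, k ≠ 0 → d (p k) + 1 = d k) {L B : ℕ} (hL : ∀ k, d k ≤ L)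
    (hedge : ∀ k : Fin (K + 1), k ≠ 0 → ∃ r : Fin m, ((e r).1 = p k ∧ (e r).2 = k) ∨ ((e r).1 = k ∧ (e r).2 = p k))
    (hB : ∀ a : Fin (K + 1), a ≠ 0 → ∀ s : Finset (Fin (K + 1)), (∀ k ∈ s, ∃ j, j < d k ∧ p^[j] k = a) → s.card ≤ B)
    (v : Fin (K + 1) → ℝ) :
    ∑ k : Fin (K + 1), v k ^ 2 ≤ 2 * (L : ℝ) * B * ∑ r : Fin m, (v (e r).1 - v (e r).2) ^ 2 + 2 * ((K : ℝ) + 1) * v 0 ^ 2 := by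
  classical
  set D : Fin (K + 1) → ℝ := fun a => (v a - v (p a)) ^ 2 with hD
  have hD0 : ∀ a, 0 ≤ D a := fun a => sq_nonneg _
  have hDzero : D 0 = 0 := by rw [hD]; dsimp only; rw [hp0, sub_self]; ring
  set X : ℝ := ∑ r : Fin m, (v (e r).1 - v (e r).2) ^ 2 with hX
  have hX0 : 0 ≤ X := sum_nonneg fun r _ => sq_nonneg _
  -- pointwise
  have hpt : ∀ k : Fin (K + 1), v k ^ 2 ≤ 2 * v 0 ^ 2 + 2 * (L : ℝ) * ∑ j ∈ range (d k), D (p^[j] k) := by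
    intro k
    have h1 := tree_sub_sq_le p d hd0 hdp v k
    have hS0 : 0 ≤ ∑ j ∈ range (d k), D (p^[j] k) := sum_nonneg fun j _ => hD0 _
    have hdk : (d k : ℝ) ≤ L := Nat.cast_le.mpr (hL k)
    have h2 : (v k - v 0) ^ 2 ≤ (L : ℝ) * ∑ j ∈ range (d k), D (p^[j] k) := le_trans h1 (mul_le_mul_of_nonneg_right hdk hS0)
    nlinarith [sq_nonneg (v k - 2 * v 0)]
  have hsum := sum_le_sum fun k (_ : k ∈ (univ : Finset (Fin (K + 1)))) => hpt k
  rw [sum_add_distrib, sum_const, card_univ, Fintype.card_fin, nsmul_eq_mul, ← mul_sum] at hsum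
  -- regroup and bound the congestion
  rw [tree_pathEnergy_regroup p d D] at hsum
  have hN : ∀ a : Fin (K + 1), a ≠ 0 → ∑ k : Fin (K + 1), (((range (d k)).filter fun j => p^[j] k = a).card : ℝ) ≤ B := by
    intro a ha
    -- the levels whose chain meets `a`
    set s : Finset (Fin (K + 1)) := univ.filter fun k => ∃ j, j < d k ∧ p^[j] k = a with hs
    have hcard : ∀ k, (((range (d k)).filter fun j => p^[j] k = a).card : ℝ) = if k ∈ s then 1 else 0 := by
      intro k
      by_cases hk : k ∈ s
      · rw [if_pos hk]
        have hle := tree_visits_le_one p d hd0 hdp k a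
        have hge : 1 ≤ ((range (d k)).filter fun j => p^[j] k = a).card := by
          rw [hs, mem_filter] at hk
          obtain ⟨j, hj, hja⟩ := hk.2
          exact card_pos.mpr ⟨j, by rw [mem_filter, mem_range]; exact ⟨hj, hja⟩⟩
        have : ((range (d k)).filter fun j => p^[j] k = a).card = 1 := le_antisymm hle hge
        rw [this]; norm_num
      · rw [if_neg hk]
        have : ((range (d k)).filter fun j => p^[j] k = a).card = 0 := by
          rw [card_eq_zero, filter_eq_empty_iff]
          intro j hj hja
          exact hk (by rw [hs, mem_filter]; exact ⟨mem_univ _, j, mem_range.mp hj, hja⟩)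
        rw [this]; norm_num
    simp_rw [hcard]
    rw [sum_ite_mem, univ_inter, sum_const, nsmul_eq_mul, mul_one]
    exact_mod_cast hB a ha s (fun k hk => by rw [hs, mem_filter] at hk; exact hk.2)
  have hreg : ∑ a : Fin (K + 1), D a * ∑ k : Fin (K + 1), (((range (d k)).filter fun j => p^[j] k = a).card : ℝ) ≤ B * ∑ a : Fin (K + 1), D a := by
    rw [mul_sum]
    refine sum_le_sum fun a _ => ?_
    by_cases ha : a = 0
    · rw [ha, hDzero, zero_mul, mul_zero]
    · calc D a * _ ≤ D a * B := mul_le_mul_of_nonneg_left (hN a ha) (hD0 a)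
        _ = B * D a := mul_comm _ _
  -- the tree pairs are distinct listed pairs: `Σ_a D a = Σ_{i : Fin K} D(i+1) ≤ X`
  have hDX : ∑ a : Fin (K + 1), D a ≤ X := by
    rw [Fin.sum_univ_succ, hDzero, zero_add]
    choose rr hrr using fun i : Fin K => hedge i.succ (Fin.succ_ne_zero i)
    have hinj : Function.Injective rr := by
      intro i j hij
      have hi := hrr i
      have hj := hrr j
      rw [hij] at hi
      -- the pairs `{i+1, p(i+1)}` and `{j+1, p(j+1)}` coincide as listed pairs
      have key : (i.succ : Fin (K + 1)) = j.succ := by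
        rcases hi with ⟨h1, h2⟩ | ⟨h1, h2⟩ <;> rcases hj with ⟨h3, h4⟩ | ⟨h3, h4⟩
        · exact h2.symm.trans h4
        · -- `(p i', i') = (j', p j')`: `p i' = j'` and `p j' = i'` contradict the depths
          exfalso
          have hpa : p i.succ = j.succ := h1.symm.trans h3
          have hpb : p j.succ = i.succ := h4.symm.trans h2
          have d1 := hdp _ (Fin.succ_ne_zero i)
          have d2 := hdp _ (Fin.succ_ne_zero j)
          rw [hpa] at d1
          rw [hpb] at d2
          omega
        · exfalso
          have hpa : p i.succ = j.succ := h2.symm.trans h4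
          have hpb : p j.succ = i.succ := h3.symm.trans h1
          have d1 := hdp _ (Fin.succ_ne_zero i)
          have d2 := hdp _ (Fin.succ_ne_zero j)
          rw [hpa] at d1
          rw [hpb] at d2
          omega
        · exact h1.symm.trans h3
      exact Fin.succ_injective _ key
    have hterm : ∀ i : Fin K, D i.succ = (v (e (rr i)).1 - v (e (rr i)).2) ^ 2 := by
      intro i
      rw [hD]; dsimp only
      rcases hrr i with ⟨h1, h2⟩ | ⟨h1, h2⟩
      · rw [h1, h2]; ring
      · rw [h1, h2]
    have : ∑ i : Fin K, D i.succ = ∑ r ∈ univ.map ⟨rr, hinj⟩, (v (e r).1 - v (e r).2) ^ 2 := by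
      rw [sum_map]; exact sum_congr rfl fun i _ => hterm i
    rw [this]
    exact sum_le_univ_sum_of_nonneg fun r => sq_nonneg _
  -- assemble
  have hL0 : (0 : ℝ) ≤ L := Nat.cast_nonneg L
  have hB0 : (0 : ℝ) ≤ B := Nat.cast_nonneg B
  have hDsum0 : 0 ≤ ∑ a : Fin (K + 1), D a := sum_nonneg fun a _ => hD0 a
  calc ∑ k : Fin (K + 1), v k ^ 2 ≤ ((K : ℝ) + 1) * (2 * v 0 ^ 2) + 2 * (L : ℝ) * ∑ a : Fin (K + 1), D a * ∑ k : Fin (K + 1), (((range (d k)).filter fun j => p^[j] k = a).card : ℝ) := by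
        have := hsum; push_cast at this ⊢; linarith
    _ ≤ ((K : ℝ) + 1) * (2 * v 0 ^ 2) + 2 * (L : ℝ) * (B * ∑ a : Fin (K + 1), D a) := by nlinarith [hreg]
    _ ≤ ((K : ℝ) + 1) * (2 * v 0 ^ 2) + 2 * (L : ℝ) * (B * X) := by nlinarith [hDX, mul_nonneg hL0 hB0]
    _ = 2 * (L : ℝ) * B * X + 2 * ((K : ℝ) + 1) * v 0 ^ 2 := by ring

/-- **THE TREE RATE FLOOR: `min{t/(2LBm), h/(2(K+1))} ≤ ρ`** for a positive solution on a list carrying such a spanning tree (`m, L, B ≥ 1`, `t, h > 0`). [ours] -/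
theorem tree_rho_ge (hm : 1 ≤ m) (ht : 0 < t) (hh : 0 < h) (hc : ∀ k, 0 < c k)
    (hvertex : ∀ k : Fin (K + 1), t / m * ∑ r : Fin m, ((if k = (e r).1 then c (e r).2 - c (e r).1 else 0) + (if k = (e r).2 then c (e r).1 - c (e r).2 else 0))
      - (if k = 0 then h * c k else 0) = -ρ * c k)
    (hp0 : p 0 = 0) (hd0 : ∀ k, d k = 0 ↔ k = 0) (hdp : ∀ k, k ≠ 0 → d (p k) + 1 = d k) {L B : ℕ} (hL1 : 1 ≤ L) (hB1 : 1 ≤ B) (hL : ∀ k, d k ≤ L)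
    (hedge : ∀ k : Fin (K + 1), k ≠ 0 → ∃ r : Fin m, ((e r).1 = p k ∧ (e r).2 = k) ∨ ((e r).1 = k ∧ (e r).2 = p k))
    (hB : ∀ a : Fin (K + 1), a ≠ 0 → ∀ s : Finset (Fin (K + 1)), (∀ k ∈ s, ∃ j, j < d k ∧ p^[j] k = a) → s.card ≤ B) :
    min (t / (2 * (L : ℝ) * B * m)) (h / (2 * ((K : ℝ) + 1))) ≤ ρ := by
  have hLpos : (0 : ℝ) < L := Nat.cast_pos.mpr (by omega)
  have hBpos : (0 : ℝ) < B := Nat.cast_pos.mpr (by omega)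
  exact groundState_rho_ge_min e hm ht hh hc hvertex (a := 2 * (L : ℝ) * B) (b := 2 * ((K : ℝ) + 1)) (by positivity) (by positivity)
    (tree_poincare e p d hp0 hd0 hdp hL hedge hB)

end Tree

end Summit.Ventures.LatticeQCDFlow.Scaling

end
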